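import Literature.Geometry.DiscreteGeometry.ShellCensusSearchSound
import Literature.Geometry.DiscreteGeometry.ShellCensusSearchRun00
import Literature.Geometry.DiscreteGeometry.ShellCensusSearchRun01
import Literature.Geometry.DiscreteGeometry.ShellCensusSearchRun02
import Literature.Geometry.DiscreteGeometry.ShellCensusSearchRun03
import Literature.Geometry.DiscreteGeometry.ShellCensusSearchRun04
import Literature.Geometry.DiscreteGeometry.ShellCensusSearchRun05
import Literature.Geometry.DiscreteGeometry.ShellCensusSearchRun06
import Literature.Geometry.DiscreteGeometry.ShellCensusSearchRun07
import Literature.Geometry.DiscreteGeometry.ShellCensusSearchRun08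
import Literature.Geometry.DiscreteGeometry.ShellCensusSearchRun09
import Literature.Geometry.DiscreteGeometry.ShellCensusSearchRun10
import Literature.Geometry.DiscreteGeometry.ShellCensusSearchRun11
import Literature.Geometry.DiscreteGeometry.ShellCensusSearchRun12
import Literature.Geometry.DiscreteGeometry.ShellCensusSearchRun13
import Literature.Geometry.DiscreteGeometry.ShellCensusSearchRun14
import Literature.Geometry.DiscreteGeometry.ShellCensusSearchRun15
import Literature.Geometry.DiscreteGeometry.ShellCensusTwelve
import HarnessLib

/-!
# The finite census of gapped twelve-shells — PROVED (computationally)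

Topic `Literature/Geometry/DiscreteGeometry`.  Assembly of the verified two-phase growth search:

* `checkPart_all` — the `16` parts of the run (`ShellCensusSearchRun00 … 15.lean`, `native_decide`);
* **`CF.concl`** — by `concl_of_parts` (`ShellCensusSearchSound.lean`): every abstract census
  frame `M : CF` (closed fan surface on twelve labels, 4-regular bond graph whose edges are sides
  and whose 3-cliques are triangles, no dead star `4T` / `3T+Q` / `3T+2H`) has, up to a bijection
  of the labels, the cuboctahedral, the anticuboctahedral or the hexagonal-antiprism bond graph;
* the dictionary from the checker's pattern graphs `patAdj 0 / 1 / 2` to the integer patterns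
  `fccVec` / `hcpVec` of `ShellCensusTwelve.lean` and to the antiprism edge list of the crux
  `GappedShellCensus.ShellTrichotomy` (by `decide`).

The run depends on the `native_decide` axiom (`Lean.ofReduceBool` / `Lean.trustCompiler`);
everything else is checked by the kernel.
-/

namespace Literature.Geometry.DiscreteGeometry

namespace ShellCensusSearch

/-- **All `16` parts of the run return `true`.** [folklore] -/
theorem checkPart_all : ∀ i, i < 16 → checkPart 10 16 i 40 = true := by
  intro i hi
  interval_cases i
  · exact checkPart_eq_true_00
  · exact checkPart_eq_true_01
  · exact checkPart_eq_true_02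
  · exact checkPart_eq_true_03
  · exact checkPart_eq_true_04
  · exact checkPart_eq_true_05
  · exact checkPart_eq_true_06
  · exact checkPart_eq_true_07
  · exact checkPart_eq_true_08
  · exact checkPart_eq_true_09
  · exact checkPart_eq_true_10
  · exact checkPart_eq_true_11
  · exact checkPart_eq_true_12
  · exact checkPart_eq_true_13
  · exact checkPart_eq_true_14
  · exact checkPart_eq_true_15

/-- **Every census frame has, up to relabelling, the cuboctahedral, the anticuboctahedral or the
antiprism bond graph.** [folklore] -/
theorem CF.concl (M : CF) : M.Concl :=
  concl_of_parts (depth := 10) (parts := 16) (fuel := 40) (by norm_num) checkPart_all M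

open Literature.Geometry.DiscreteGeometry.ShellCensus in
/-- Pattern `0` is the cuboctahedral graph of `fccVec` (squared bond `2`). [folklore] -/
theorem patAdj0_iff : ∀ v w : Fin 12, patAdj 0 v w = true ↔ sqNormInt (fccVec v - fccVec w) = 2 := by decide

open Literature.Geometry.DiscreteGeometry.ShellCensus in
/-- Pattern `1` is the anticuboctahedral graph of `hcpVec` (squared bond `18`). [folklore] -/
theorem patAdj1_iff : ∀ v w : Fin 12, patAdj 1 v w = true ↔ sqNormInt (hcpVec v - hcpVec w) = 18 := by decide

/-- Pattern `2` is the labelled antiprism (`apPairs`, the edge list of the crux). [folklore] -/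
theorem patAdj2_iff : ∀ v w : Fin 12, v ≠ w → (patAdj 2 v w = true ↔ (min v.val w.val, max v.val w.val) ∈ apPairs) := by
  decide

/-- No loop in the antiprism list. [folklore] -/
theorem apPairs_irrefl : ∀ v : Fin 12, (min v.val v.val, max v.val v.val) ∉ apPairs := by decide

end ShellCensusSearch

end Literature.Geometry.DiscreteGeometry
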